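import Summits.BirchSwinnertonDyer.BirchSwinnertonDyer.Theorems.ManinLocalTwoThreeComplexAutSupply
import Literature.NumberTheory.EllipticCurves.TwoDescent
import HarnessLib

/-!
# Kummer injectivity for quadratic characters on `Aut_ℚ(ℂ)`: reading square classes from Galois behaviour
(route `ManinLocalTwoThree`, crux C2 `ManinOddAtFour` stmt-BirchSwinnertonDyer-22967; cell bsd-f2-manin, C2/C3 LEAD p1 gen 19;
`--supports stmt-BirchSwinnertonDyer-22967`; D5→D6 bridge of E-es-185: turns «`σ(√δ)/√δ = σ(√D)/√D` for all `σ : ℂ ≃ₐ[ℚ] ℂ`» —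
which is what THEOREM K (`indexFour_kummerDiamondReciprocity` + `TwoDescentKummerBridge`) delivers for `δ = x(R_Q) − eᵢ` against the
cyclotomic classes `D ∈ {−1, ±2, q*}` — into `sqClass δ = sqClass D`, the currency of `KummerDiamondStepTwo.descent_table_of_diamond_classes`)

* `exists_sq_eq_of_forall_algEquiv_apply_eq` — `w² = δ ∈ ℚ` and `σ w = w` for every `σ` ⟹ `δ` is a square in `ℚ`
  (contrapositive of `exists_complex_algEquiv_neg_sqrt`).
* `sqClass_eq_of_forall_kummer_eq` — `w² = δ`, `v² = D` (`δ, D ∈ ℚˣ`) and `σ(w)·v = w·σ(v)` for every `σ` ⟹ `[δ] = [D]` in `ℚˣ/ℚˣ²`.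

Pure field theory; nothing about C2, Manin's conjecture or BSD is proved here.  [folklore]
-/

set_option autoImplicit false
-- lint-debt: the directory name repeats the summit name (sibling precedent `ManinLocalTwoThreeComplexAutExtension.lean`)
set_option linter.dupNamespace false

noncomputable section

open scoped Classical
open WeierstrassCurve.Affine

namespace Summit.BirchSwinnertonDyer.BirchSwinnertonDyer.Theorems.ManinLocalTwoThree.ComplexAut

/-- **Kummer injectivity (trivial class).**  If `w ∈ ℂ` with `w² = δ`, `δ ∈ ℚ`, is fixed by every `ℚ`-algebra automorphism of `ℂ`,
then `δ` is a square in `ℚ`. [folklore] -/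
theorem exists_sq_eq_of_forall_algEquiv_apply_eq (δ : ℚ) (w : ℂ) (hw : w ^ 2 = (δ : ℂ))
    (h : ∀ σ : ℂ ≃ₐ[ℚ] ℂ, σ w = w) : ∃ b : ℚ, b ^ 2 = δ := by
  by_contra hns
  have hδ : ∀ b : ℚ, b ^ 2 ≠ δ := fun b hb => hns ⟨b, hb⟩
  obtain ⟨σ, hσ⟩ := exists_complex_algEquiv_neg_sqrt δ hδ w hw
  have hw0 : w ≠ 0 := by
    intro h0
    apply hδ 0
    have : ((0 : ℚ) : ℂ) ^ 2 = (δ : ℂ) := by rw [← hw, h0]; simp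
    exact_mod_cast this
  have : w = -w := (h σ).symm.trans hσ
  exact hw0 (by linear_combination this / 2)

/-- **Kummer injectivity (equal classes).**  Let `δ, D ∈ ℚˣ`, `w² = δ`, `v² = D` in `ℂ`.  If every `ℚ`-algebra automorphism `σ` of `ℂ`
moves `w` and `v` by the same sign — `σ(w)·v = w·σ(v)` — then `δ` and `D` have the same square class: `sqClass δ = sqClass D`.
[folklore] -/
theorem sqClass_eq_of_forall_kummer_eq {δ D : ℚ} (hδ : δ ≠ 0) (hD : D ≠ 0) {w v : ℂ} (hw : w ^ 2 = (δ : ℂ))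
    (hv : v ^ 2 = (D : ℂ)) (h : ∀ σ : ℂ ≃ₐ[ℚ] ℂ, σ w * v = w * σ v) : sqClass δ = sqClass D := by
  have hv0 : v ≠ 0 := by
    intro h0; rw [h0] at hv
    exact hD (by exact_mod_cast (show ((D : ℚ) : ℂ) = 0 by rw [← hv]; simp))
  -- `u := w / v` has `u² = δ/D` and is fixed by every `σ`
  have hu : (w / v) ^ 2 = ((δ / D : ℚ) : ℂ) := by
    push_cast
    rw [div_pow, hw, hv]
  have hfix : ∀ σ : ℂ ≃ₐ[ℚ] ℂ, σ (w / v) = w / v := by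
    intro σ
    have hσv : σ v ≠ 0 := fun h0 => hv0 (by simpa using congrArg σ.symm h0)
    rw [map_div₀, div_eq_div_iff hσv hv0]
    exact h σ
  obtain ⟨b, hb⟩ := exists_sq_eq_of_forall_algEquiv_apply_eq (δ / D) (w / v) hu hfix
  -- `δ = D · b²`
  have hb' : δ * D = (D * b) ^ 2 := by
    field_simp at hb
    linear_combination (-D) * hb
  -- hence equal square classes
  have hmul : sqClass (δ * D) = 1 := by rw [hb', sqClass_sq]
  have : sqClass δ * sqClass D = 1 := by rw [← sqClass_mul hδ hD]; exact hmul
  calc sqClass δ = sqClass δ * (sqClass D * sqClass D) := by rw [SqUnits.mul_self, SqUnits.mul_one]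
    _ = (sqClass δ * sqClass D) * sqClass D := by rw [mul_assoc]
    _ = sqClass D := by rw [this, SqUnits.one_mul]

end Summit.BirchSwinnertonDyer.BirchSwinnertonDyer.Theorems.ManinLocalTwoThree.ComplexAut

end
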